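import Summits.AnomalousDissipation.AnomalousDissipation.Theorems.TaylorCertificatePair.Negative.Modes

/-!
# Fourier coefficients, norms and gradient norms of mode sums; the differential of a band-limited functional

Crux `TaylorCertificates.TaylorCertificatePair` (stmt-AnomalousDissipation-13037), negative side
(cdisprove seat `refuter-cdisprove-stmt-AnomalousDissipation-13037-0`): support for the refutation
`Theorems/TaylorCertificatesTaylorCertificatePairRefutation.lean` (CEILING killed by an unresolved beat).
All statements are written over the tree's objects directly (no new definitions): single real modes
`Torus.realTrigPoly {k} (fun _ => z) = Re (e_k • z)`, mode sums `∑ₘ Torus.realTrigPoly {k m} (fun _ => z m)`,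
Fourier coefficients `mFourierCoeff (complexify ∘ ·)`, the transversal products `(fun j => (κ j : ℂ)) ⬝ᵥ z`.

* Fourier coefficients of modes and mode sums, band limitation, `‖∇u‖² ≤ 4π²L² ∫‖u‖²`, crude and exact energies;
* the differential `Φ'(u)` of a cylindrical test functional with band-limited test fields: smooth, divergence free,
  mean zero, band-limited (`fc_grad_eq_zero`), transversal coefficients (`dotc_fc_grad`), no zero mode;
* the two inertial evaluations `inertial_shear` (zero) and `inertial_three` (only the beat survives).
-/

noncomputable section

open MeasureTheory UnitAddTorus Matrix
open scoped InnerProductSpace ENNReal ComplexConjugate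

namespace Summit.AnomalousDissipation.AnomalousDissipation.Theorems.TaylorCertificatePair.Negative

open Literature.Analysis.FunctionSpaces Literature.Analysis.FluidPDE

variable {n : ℕ} {k : Fin n → (Fin 3 → ℤ)} {z : Fin n → (EuclideanSpace ℂ (Fin 3))}

/-! ### Fourier coefficients, norms and gradient norms of mode sums -/

/-- Fourier coefficients of a single real mode: supported on `{k, -k}`. -/
theorem fc_mode (k₀ : Fin 3 → ℤ) (z₀ : (EuclideanSpace ℂ (Fin 3))) (κ : Fin 3 → ℤ) :
    (mFourierCoeff (EuclideanSpace.complexify ∘ ((Torus.realTrigPoly {k₀} (fun _ => z₀)))) κ) =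
      (2 : ℂ)⁻¹ • ((if κ = k₀ then z₀ else 0) + EuclideanSpace.conjVec (if κ = -k₀ then z₀ else 0)) :=
  Torus.mFourierCoeff_realTrigPoly_singleton k₀ _ κ

/-- A single real mode has no Fourier coefficients at longer frequencies. -/
theorem fc_mode_eq_zero {k₀ κ : Fin 3 → ℤ} (z₀ : (EuclideanSpace ℂ (Fin 3))) (h : Torus.freqNormSq k₀ < Torus.freqNormSq κ) :
    (mFourierCoeff (EuclideanSpace.complexify ∘ ((Torus.realTrigPoly {k₀} (fun _ => z₀)))) κ) = 0 :=
  Torus.mFourierCoeff_realTrigPoly_singleton_eq_zero k₀ _ h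

/-- Fourier coefficients of a mode sum are the sums of the coefficients of the modes. -/
theorem fc_modes (κ : Fin 3 → ℤ) : (mFourierCoeff (EuclideanSpace.complexify ∘ ((∑ mm, Torus.realTrigPoly {k mm} (fun _ => z mm)))) κ) = ∑ m, (mFourierCoeff (EuclideanSpace.complexify ∘ ((Torus.realTrigPoly {(k m)} (fun _ => (z m))))) κ) := by
  have h : EuclideanSpace.complexify ∘ (∑ mm, Torus.realTrigPoly {k mm} (fun _ => z mm)) =
      fun x => ∑ m ∈ Finset.univ, (EuclideanSpace.complexify ∘ (Torus.realTrigPoly {(k m)} (fun _ => (z m)))) x := by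
    funext x
    simp [map_sum]
  rw [h, Torus.mFourierCoeff_finset_sum _ (fun m _ =>
    Torus.integrable_complexify_comp (isSmooth_mode _ _).integrable)]

/-- Mode sums are band-limited by the largest frequency. -/
theorem fc_modes_eq_zero {L : ℕ} (hL : ∀ m, Torus.freqNormSq (k m) ≤ (L : ℝ) ^ 2)
    (κ : Fin 3 → ℤ) (hκ : (L : ℝ) ^ 2 < Torus.freqNormSq κ) :
    mFourierCoeff (EuclideanSpace.complexify ∘ (∑ mm, Torus.realTrigPoly {k mm} (fun _ => z mm))) κ = 0 := by
  rw [fc_modes]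
  exact Finset.sum_eq_zero fun m _ => fc_mode_eq_zero _ ((hL m).trans_lt hκ)

/-- Gradient norm of a mode sum: `‖∇u‖² ≤ 4π² L² ∫ ‖u‖²` if all frequencies have `|k|² ≤ L²`. -/
theorem toReal_eGradNormSq_modes_le {L : ℕ} (hL : ∀ m, Torus.freqNormSq (k m) ≤ (L : ℝ) ^ 2) :
    (Torus.eGradNormSq ((∑ mm, Torus.realTrigPoly {k mm} (fun _ => z mm)))).toReal ≤ 4 * Real.pi ^ 2 * (L : ℝ) ^ 2 * ∫ x, ‖(∑ mm, Torus.realTrigPoly {k mm} (fun _ => z mm)) x‖ ^ 2 := by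
  rw [Torus.eGradNormSq_eq_sum_of_band_limited (continuous_modes k z) (fc_modes_eq_zero hL),
    Torus.integral_norm_sq_eq_sum_of_band_limited (continuous_modes k z) (fc_modes_eq_zero hL),
    ENNReal.toReal_ofReal (mul_nonneg (by positivity) (Finset.sum_nonneg fun κ _ =>
      mul_nonneg (Torus.freqNormSq_nonneg κ) (sq_nonneg _)))]
  have key : ∑ κ ∈ Torus.freqBall L, Torus.freqNormSq κ *
        ‖mFourierCoeff (EuclideanSpace.complexify ∘ (∑ mm, Torus.realTrigPoly {k mm} (fun _ => z mm))) κ‖ ^ 2 ≤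
      (L : ℝ) ^ 2 * ∑ κ ∈ Torus.freqBall L, ‖mFourierCoeff (EuclideanSpace.complexify ∘ (∑ mm, Torus.realTrigPoly {k mm} (fun _ => z mm))) κ‖ ^ 2 := by
    rw [Finset.mul_sum]
    exact Finset.sum_le_sum fun κ hκ =>
      mul_le_mul_of_nonneg_right (Torus.mem_freqBall.1 hκ) (sq_nonneg _)
  calc 4 * Real.pi ^ 2 * ∑ κ ∈ Torus.freqBall L, Torus.freqNormSq κ *
        ‖mFourierCoeff (EuclideanSpace.complexify ∘ (∑ mm, Torus.realTrigPoly {k mm} (fun _ => z mm))) κ‖ ^ 2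
      ≤ 4 * Real.pi ^ 2 * ((L : ℝ) ^ 2 *
        ∑ κ ∈ Torus.freqBall L, ‖mFourierCoeff (EuclideanSpace.complexify ∘ (∑ mm, Torus.realTrigPoly {k mm} (fun _ => z mm))) κ‖ ^ 2) :=
        mul_le_mul_of_nonneg_left key (by positivity)
    _ = _ := by ring

/-- Mode sums have finite spectral gradient norm. -/
theorem eGradNormSq_modes_ne_top : Torus.eGradNormSq ((∑ mm, Torus.realTrigPoly {k mm} (fun _ => z mm))) ≠ ⊤ :=
  (Torus.eGradNormSq_lt_top (isSmooth_modes k z)).ne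

/-- Pointwise bound `‖modes k z x‖ ≤ ∑ ‖z_m‖`. -/
theorem norm_modes_le (x : (UnitAddTorus (Fin 3))) : ‖(∑ mm, Torus.realTrigPoly {k mm} (fun _ => z mm)) x‖ ≤ ∑ m, ‖z m‖ := by
  rw [modes_apply]
  exact (norm_sum_le _ _).trans (Finset.sum_le_sum fun m _ =>
    Torus.norm_realTrigPoly_singleton_le _ _ x)

/-- Crude energy bound `∫ ‖modes k z‖² ≤ (∑ ‖z_m‖)²` (the torus has volume one). -/
theorem integral_norm_sq_modes_le : ∫ x, ‖(∑ mm, Torus.realTrigPoly {k mm} (fun _ => z mm)) x‖ ^ 2 ≤ (∑ m, ‖z m‖) ^ 2 := by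
  have h : ∫ x, ‖(∑ mm, Torus.realTrigPoly {k mm} (fun _ => z mm)) x‖ ^ 2 ≤ ∫ _ : (UnitAddTorus (Fin 3)), (∑ m, ‖z m‖) ^ 2 := by
    refine integral_mono ((memLp_modes k z).integrable_norm_pow two_ne_zero) (integrable_const _)
      fun x => ?_
    exact pow_le_pow_left₀ (norm_nonneg _) (norm_modes_le x) 2
  simpa using h

/-- Exact energy of a single mode with nonzero frequency: `∫ ‖mode k z‖² = ½ ‖z‖²`. -/
theorem integral_norm_sq_mode {k₀ : Fin 3 → ℤ} (hk₀ : k₀ ≠ 0) (z₀ : (EuclideanSpace ℂ (Fin 3))) :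
    ∫ x, ‖(Torus.realTrigPoly {k₀} (fun _ => z₀)) x‖ ^ 2 = 2⁻¹ * ‖z₀‖ ^ 2 := by
  have h1 : ∫ x, ‖(Torus.realTrigPoly {k₀} (fun _ => z₀)) x‖ ^ 2 = ∫ x, ⟪(Torus.realTrigPoly {k₀} (fun _ => z₀)) x, (Torus.realTrigPoly {k₀} (fun _ => z₀)) x⟫_ℝ :=
    integral_congr_ae (ae_of_all _ fun x => (real_inner_self_eq_norm_sq _).symm)
  rw [h1, integral_inner_mode_left (isSmooth_mode k₀ z₀).integrable]
  change (⟪z₀, (mFourierCoeff (EuclideanSpace.complexify ∘ ((Torus.realTrigPoly {k₀} (fun _ => z₀)))) k₀)⟫_ℂ).re = _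
  have hne : k₀ ≠ -k₀ := by
    intro h
    apply hk₀
    funext i
    have hi := congrFun h i
    simp only [Pi.neg_apply] at hi
    simp only [Pi.zero_apply]
    omega
  rw [fc_mode, if_pos rfl, if_neg hne, EuclideanSpace.conjVec_zero,
    add_zero, inner_smul_right]
  have h2 : (⟪z₀, z₀⟫_ℂ) = ((‖z₀‖ ^ 2 : ℝ) : ℂ) := by
    rw [inner_self_eq_norm_sq_to_K]; norm_cast
  rw [h2, show (2 : ℂ)⁻¹ * (((‖z₀‖ ^ 2 : ℝ)) : ℂ) = (((2 : ℝ)⁻¹ * ‖z₀‖ ^ 2 : ℝ) : ℂ) by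
    push_cast; ring, Complex.ofReal_re]

/-! ### The differential of a band-limited cylindrical test functional -/

section Grad

variable (Φ : Torus.CylindricalTest (Fin 3)) {N : ℕ}

/-- The differential of a cylindrical test functional is smooth. -/
theorem isSmooth_grad (u : (Torus.energySpace (Fin 3))) : Torus.IsSmooth (Φ.grad u) :=
  Torus.CylindricalTest.isSmooth_grad_holds Φ u

/-- The differential of a cylindrical test functional is divergence free. -/
theorem isDivFree_grad (u : (Torus.energySpace (Fin 3))) : Torus.IsDivFree (Φ.grad u) :=
  Torus.CylindricalTest.isDivFree_grad_holds Φ u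

/-- The differential of a cylindrical test functional has zero mean. -/
theorem hasZeroMean_grad (u : (Torus.energySpace (Fin 3))) : Torus.HasZeroMean (Φ.grad u) :=
  Torus.CylindricalTest.hasZeroMean_grad_holds Φ u

/-- Band-limited test fields have no Fourier coefficients outside the ball. -/
theorem fc_g_eq_zero (hΦ : ∀ i, Torus.fourierTruncate N (Φ.g i) = Φ.g i) (i : Fin Φ.m)
    (κ : Fin 3 → ℤ) (hκ : (N : ℝ) ^ 2 < Torus.freqNormSq κ) : (mFourierCoeff (EuclideanSpace.complexify ∘ (Φ.g i)) κ) = 0 := by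
  rw [← hΦ i, Torus.fourierTruncate_eq]
  exact Torus.mFourierCoeff_realTrigPoly_freqBall_eq_zero _ hκ

/-- The differential `Φ'(u)` of a band-limited cylindrical functional is band-limited. -/
theorem fc_grad_eq_zero (hΦ : ∀ i, Torus.fourierTruncate N (Φ.g i) = Φ.g i) (u : (Torus.energySpace (Fin 3)))
    (κ : Fin 3 → ℤ) (hκ : (N : ℝ) ^ 2 < Torus.freqNormSq κ) :
    mFourierCoeff (EuclideanSpace.complexify ∘ Φ.grad u) κ = 0 := by
  rw [Torus.CylindricalTest.grad_eq_sum_smul]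
  set c : Fin Φ.m → ℝ := fun i => _root_.fderiv ℝ Φ.φ (Φ.coords u) (EuclideanSpace.single i 1)
  have h : (EuclideanSpace.complexify ∘ fun x => ∑ i ∈ Finset.univ, c i • Φ.g i x) =
      fun x => ∑ i ∈ Finset.univ, ((c i : ℂ) • (EuclideanSpace.complexify ∘ Φ.g i)) x := by
    funext x
    simp only [Function.comp_apply, map_sum, Pi.smul_apply, LinearIsometry.map_smul,
      Complex.coe_smul]
  rw [h, Torus.mFourierCoeff_finset_sum _ (fun i _ =>
    (Torus.integrable_complexify_comp (Φ.g_smooth i).integrable).smul _)]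
  refine Finset.sum_eq_zero fun i _ => ?_
  rw [Torus.mFourierCoeff_const_smul]
  change (c i : ℂ) • (mFourierCoeff (EuclideanSpace.complexify ∘ (Φ.g i)) κ) = 0
  rw [fc_g_eq_zero Φ hΦ i κ hκ, smul_zero]

/-- Fourier coefficients of the differential are transversal (it is divergence free). -/
theorem dotc_fc_grad (u : (Torus.energySpace (Fin 3))) (κ : Fin 3 → ℤ) : ((fun j => ((κ) j : ℂ)) ⬝ᵥ (WithLp.ofLp (((mFourierCoeff (EuclideanSpace.complexify ∘ (Φ.grad u)) κ))))) = 0 :=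
  (isDivFree_grad Φ u).sum_mul_mFourierCoeff_eq_zero (isSmooth_grad Φ u) κ

/-- The zero mode of the differential vanishes (it has zero mean). -/
theorem fc_grad_zero (u : (Torus.energySpace (Fin 3))) : (mFourierCoeff (EuclideanSpace.complexify ∘ (Φ.grad u)) 0) = 0 :=
  Torus.mFourierCoeff_complexify_zero_of_hasZeroMean (isSmooth_grad Φ u).integrable
    (hasZeroMean_grad Φ u)

/-- States with the same coordinates have the same differential. -/
theorem grad_eq_of_coords_eq {u v : (Torus.energySpace (Fin 3))} (h : Φ.coords u = Φ.coords v) : Φ.grad u = Φ.grad v := by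
  unfold Torus.CylindricalTest.grad
  rw [h]

/-- The Laplacian pairing of a mode sum with the differential, in Fourier variables. -/
theorem integral_inner_modes_laplacian {G : (UnitAddTorus (Fin 3)) → (EuclideanSpace ℝ (Fin 3))} (hG : Torus.IsSmooth G) :
    ∫ x, ⟪(∑ mm, Torus.realTrigPoly {k mm} (fun _ => z mm)) x, Torus.laplacian G x⟫_ℝ =
      ∑ m, (⟪z m, -(((4 * Real.pi ^ 2 * Torus.freqNormSq (k m) : ℝ) : ℂ) • (mFourierCoeff (EuclideanSpace.complexify ∘ G) (k m)))⟫_ℂ).re := by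
  rw [integral_inner_modes_left hG.laplacian.integrable]
  refine Finset.sum_congr rfl fun m _ => ?_
  rw [Torus.mFourierCoeff_complexify_laplacian hG]

end Grad

/-! ### Algebra of `dotc` -/

/-- `dotc` is additive in the frequency. -/
theorem dotc_add_left (a b : Fin 3 → ℤ) (w : (EuclideanSpace ℂ (Fin 3))) : ((fun j => (((a + b)) j : ℂ)) ⬝ᵥ (WithLp.ofLp (w))) = ((fun j => ((a) j : ℂ)) ⬝ᵥ (WithLp.ofLp (w))) + ((fun j => ((b) j : ℂ)) ⬝ᵥ (WithLp.ofLp (w))) := by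
  simp only [dotProduct, Pi.add_apply, Int.cast_add, add_mul, Finset.sum_add_distrib]

/-- `dotc` is odd in the frequency. -/
theorem dotc_neg_left (a : Fin 3 → ℤ) (w : (EuclideanSpace ℂ (Fin 3))) : ((fun j => (((-a)) j : ℂ)) ⬝ᵥ (WithLp.ofLp (w))) = -((fun j => ((a) j : ℂ)) ⬝ᵥ (WithLp.ofLp (w))) := by
  simp only [dotProduct, Pi.neg_apply, Int.cast_neg, neg_mul, Finset.sum_neg_distrib]

/-- `dotc 0 w = 0`. -/
@[simp] theorem dotc_zero_left (w : (EuclideanSpace ℂ (Fin 3))) :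
    ((fun j => (((0 : Fin 3 → ℤ)) j : ℂ)) ⬝ᵥ (WithLp.ofLp (w))) = 0 := by
  simp [dotProduct]

/-! ### The concrete states: a far shear mode plus two unresolved beating modes -/

/-- `e₂ ≠ 0`. -/
theorem e2_ne_zero : (![0, 1, 0] : Fin 3 → ℤ) ≠ 0 := by
  intro h
  have := congrFun h 1
  simp at this

/-- `|e₂|² = 1`. -/
theorem freqNormSq_e2 : Torus.freqNormSq (![0, 1, 0] : Fin 3 → ℤ) = 1 := by
  simp [Torus.freqNormSq, Fin.sum_univ_three]

/-- `‖ê₀‖ = 1`. -/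
theorem norm_zhat : ‖(EuclideanSpace.complexify (EuclideanSpace.single (0 : Fin 3) (1 : ℝ)) : EuclideanSpace ℂ (Fin 3))‖ = 1 := by
  rw [EuclideanSpace.norm_complexify, PiLp.norm_single, norm_one]

/-- The shear polarisation is transversal: `e₂ · (c ê₀) = 0`. -/
theorem dotc_e2_smul_zhat (c : ℂ) : ((fun j => (((![0, 1, 0] : Fin 3 → ℤ)) j : ℂ)) ⬝ᵥ (WithLp.ofLp ((c • (EuclideanSpace.complexify (EuclideanSpace.single (0 : Fin 3) (1 : ℝ)) : EuclideanSpace ℂ (Fin 3)))))) = 0 := by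
  simp [dotProduct, Fin.sum_univ_three]

/-- Inertial term of the single shear mode against any smooth field: zero. -/
theorem inertial_shear {G : (UnitAddTorus (Fin 3)) → (EuclideanSpace ℝ (Fin 3))} (hG : Torus.IsSmooth G) (zs : (EuclideanSpace ℂ (Fin 3))) (hs : ((fun j => (((![0, 1, 0] : Fin 3 → ℤ)) j : ℂ)) ⬝ᵥ (WithLp.ofLp (zs))) = 0) :
    ∫ x, ⟪Torus.fderiv G x ((∑ mm, Torus.realTrigPoly {![(![0, 1, 0] : Fin 3 → ℤ)] mm} (fun _ => ![zs] mm)) x), (∑ mm, Torus.realTrigPoly {![(![0, 1, 0] : Fin 3 → ℤ)] mm} (fun _ => ![zs] mm)) x⟫_ℝ = 0 := by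
  rw [inertial_modes hG]
  have d00 : ((fun j => ((((![0, 1, 0] : Fin 3 → ℤ) + (![0, 1, 0] : Fin 3 → ℤ))) j : ℂ)) ⬝ᵥ (WithLp.ofLp (zs))) = 0 := by rw [dotc_add_left, hs, add_zero]
  simp only [Fin.sum_univ_one, Matrix.cons_val_fin_one, sub_self, dotc_zero_left,
    d00, zero_mul, mul_zero, map_zero, Complex.zero_im, add_zero]

/-- **The beat.** Inertial term of shear + two unresolved modes `p`, `p' = p + q` against a smooth
band-limited `G`: only the `(p, p')` interaction at the resolved beat frequency `q` survives. -/
theorem inertial_three {G : (UnitAddTorus (Fin 3)) → (EuclideanSpace ℝ (Fin 3))} (hG : Torus.IsSmooth G) (p q : Fin 3 → ℤ) (zs zA zB : (EuclideanSpace ℂ (Fin 3)))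
    (hs : ((fun j => (((![0, 1, 0] : Fin 3 → ℤ)) j : ℂ)) ⬝ᵥ (WithLp.ofLp (zs))) = 0) (hA : ((fun j => ((p) j : ℂ)) ⬝ᵥ (WithLp.ofLp (zA))) = 0) (hB : ((fun j => (((p + q)) j : ℂ)) ⬝ᵥ (WithLp.ofLp (zB))) = 0)
    (h1 : (mFourierCoeff (EuclideanSpace.complexify ∘ G) ((![0, 1, 0] : Fin 3 → ℤ) + p)) = 0) (h2 : (mFourierCoeff (EuclideanSpace.complexify ∘ G) (p - (![0, 1, 0] : Fin 3 → ℤ))) = 0) (h3 : (mFourierCoeff (EuclideanSpace.complexify ∘ G) (p + (![0, 1, 0] : Fin 3 → ℤ))) = 0)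
    (h4 : (mFourierCoeff (EuclideanSpace.complexify ∘ G) ((![0, 1, 0] : Fin 3 → ℤ) - p)) = 0) (h5 : (mFourierCoeff (EuclideanSpace.complexify ∘ G) ((![0, 1, 0] : Fin 3 → ℤ) + (p + q))) = 0) (h6 : (mFourierCoeff (EuclideanSpace.complexify ∘ G) ((p + q) - (![0, 1, 0] : Fin 3 → ℤ))) = 0)
    (h7 : (mFourierCoeff (EuclideanSpace.complexify ∘ G) ((p + q) + (![0, 1, 0] : Fin 3 → ℤ))) = 0) (h8 : (mFourierCoeff (EuclideanSpace.complexify ∘ G) ((![0, 1, 0] : Fin 3 → ℤ) - (p + q))) = 0)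
    (h9 : (mFourierCoeff (EuclideanSpace.complexify ∘ G) (p + (p + q))) = 0) (h10 : (mFourierCoeff (EuclideanSpace.complexify ∘ G) ((p + q) + p)) = 0) (h0 : (mFourierCoeff (EuclideanSpace.complexify ∘ G) 0) = 0)
    (hAq : ⟪(mFourierCoeff (EuclideanSpace.complexify ∘ G) (-q)), zA⟫_ℂ = 0) :
    ∫ x, ⟪Torus.fderiv G x ((∑ mm, Torus.realTrigPoly {![(![0, 1, 0] : Fin 3 → ℤ), p, p + q] mm} (fun _ => ![zs, zA, zB] mm)) x),
        (∑ mm, Torus.realTrigPoly {![(![0, 1, 0] : Fin 3 → ℤ), p, p + q] mm} (fun _ => ![zs, zA, zB] mm)) x⟫_ℝ =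
      Real.pi * (conj (((fun j => ((q) j : ℂ)) ⬝ᵥ (WithLp.ofLp (zA)))) * ⟪(mFourierCoeff (EuclideanSpace.complexify ∘ G) q), zB⟫_ℂ).im := by
  rw [inertial_modes hG]
  have e1 : p + q - p = q := add_sub_cancel_left p q
  have e2' : p - (p + q) = -q := by abel
  have d00 : ((fun j => ((((![0, 1, 0] : Fin 3 → ℤ) + (![0, 1, 0] : Fin 3 → ℤ))) j : ℂ)) ⬝ᵥ (WithLp.ofLp (zs))) = 0 := by rw [dotc_add_left, hs, add_zero]
  have d11 : ((fun j => (((p + p)) j : ℂ)) ⬝ᵥ (WithLp.ofLp (zA))) = 0 := by rw [dotc_add_left, hA, add_zero]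
  have d22 : ((fun j => (((p + q + (p + q))) j : ℂ)) ⬝ᵥ (WithLp.ofLp (zB))) = 0 := by rw [dotc_add_left, hB, add_zero]
  have hA2 : ((fun j => (((p + q - p)) j : ℂ)) ⬝ᵥ (WithLp.ofLp (zA))) = ((fun j => ((q) j : ℂ)) ⬝ᵥ (WithLp.ofLp (zA))) := by rw [e1]
  simp only [Fin.sum_univ_three, Matrix.cons_val_zero, Matrix.cons_val_one, Matrix.cons_val_two,
    Matrix.head_cons, Matrix.tail_cons, sub_self, dotc_zero_left, d00, d11, d22, hA2, e2',
    h1, h2, h3, h4, h5, h6, h7, h8, h9, h10, h0, hAq, zero_mul, mul_zero, map_zero,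
    inner_zero_left, Complex.zero_im, add_zero, zero_add]
  rw [e1]

end Summit.AnomalousDissipation.AnomalousDissipation.Theorems.TaylorCertificatePair.Negative
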